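import Summits.ResolutionOfSingularities.ResolutionOfSingularities.Theses.HomologicalConductor
import HarnessLib

/-!
# Route `HomologicalConductor`, assembly item `Assembly` (stmt-ResolutionOfSingularities-20726)

The assembly of route `HomologicalConductor` (rev 7): the chain
`PersistenceRadical → StrictDrop → NoZenoR → Globalisation → ResolutionOfSingularities`.
It is literally the type of the route's deciding theorem `closes`, whose proof is the
composition `fun hPR hD hT hG p hp => hG p hp (hT hPR hD p hp)`; we give the `closes`-free
bookkeeping term so that the file depends on the route definitions only.

OURS (cell res-hironaka, W4.4): a glue statement of the route, NOT a statement of the manuscript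
under review (Hironaka 2017); AI-written, weaker than expert review.
-/

set_option linter.dupNamespace false

namespace Summit.ResolutionOfSingularities.ResolutionOfSingularities.Theorems

open Summit.ResolutionOfSingularities.ResolutionOfSingularities.Theses.HomologicalConductor

/-- The assembly item of route `HomologicalConductor` (stmt-ResolutionOfSingularities-20726):
`PersistenceRadical → StrictDrop → NoZenoR → Globalisation → ResolutionOfSingularities`.
Proof: `NoZenoR` applied to `PersistenceRadical` and `StrictDrop` is valuative termination of the
canonical ca-tower in every characteristic `p`, and `Globalisation` turns that into
`ResolutionInChar p` for every prime `p`, which is `ResolutionOfSingularities` by definition. -/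
theorem homologicalConductor_assembly_proof :
    Summit.ResolutionOfSingularities.ResolutionOfSingularities.Theses.HomologicalConductor.Assembly := by
  unfold Assembly
  intro hPR hD hT hG p hp
  exact hG p hp (hT hPR hD p hp)

end Summit.ResolutionOfSingularities.ResolutionOfSingularities.Theorems
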